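import Summits.CriticalPhenomena.PercolationContinuityZ3.Theses.PercBudgetLadder
import Literature.Probability.Percolation.MinOpenCut
import Literature.Probability.Percolation.SharpnessDCTProofs

/-!
# `DefectDimension` (crux `stmt-CriticalPhenomena-5250`, route `PercBudgetLadder`): the subcritical
# side — below `p_c` the crux's conclusion holds with every saving

Support file of the crux disprover (cdisprove seat), all `sorry`-free, complementing
`Negative/AllOpenCutsets.lean` (not imported, to stay independent of it) (`defectDimension_false_at_one`: the crux's statement is FALSE at
`p = 1`). Here: for every `p < p_c(ℤ³)` and EVERY `c : ℝ`,
`P_p(E_n(n^{2-c})) → 1` (`defectDimension_shape_below_critical`), because already the budget-`0`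
event (plain blocking of the annulus `A(n,2n)`) has probability `→ 1`:

* `real_crossingEvent_le` — the union bound `P_p(B(n) ↔ ∂B(2n) in B(2n)) ≤ (2n+1)³ · P_p(0 ↔ ∂B(n))`
  (a crossing from `x ∈ B(n)` contains an arm of length `n` at `x`; translation invariance
  `DCT16.real_armEvent`), valid at every `p`;
* sharpness `DCT16.perc_sharpness_holds` (`P_p(0 ↔ ∂B(n)) ≤ e^{-ψ n}` for `p < p_c`, proved in the
  tree) then gives `P_p(crossed) ≤ (2n+1)³ e^{-ψ n} → 0`.

So `{p | the crux's conclusion holds at p}` contains `[0, p_c)` and not `1`: the crux is EXACTLY the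
critical case (conjecturally false on all of `(p_c, 1]` by the supercritical flow LLN), and no
argument monotone or perturbative in `p` reaches it.
-/

noncomputable section

namespace Summit.CriticalPhenomena.PercolationContinuityZ3.Theorems.DefectDimension.Negative

open MeasureTheory ProbabilityTheory Filter
open Literature.Probability.Percolation Literature.Probability.LatticeModels
open scoped Topology

/-- The annulus-crossing event `{B(n) ↔ ∂B(2n) inside B(2n)}` (`= {MinCut(n,2n) ≥ 1}`, the
complement of the blocked event of the route's target `CritAnnulusBlockedIO` at aspect `2`). -/
def crossingEvent (n : ℕ) : Set (BondConfig (Site 3)) :=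
  {ω | ∃ x ∈ box 3 n, ∃ y ∈ innerBoundary (zdGraph 3) (box 3 (2 * n)),
      ω ∈ openConnIn (↑(box 3 (2 * n)) : Set (Site 3)) x y}

/-- The crossing event is measurable (finite union of `openConnIn` events of a finite box). [folklore] -/
theorem measurableSet_crossingEvent (n : ℕ) : MeasurableSet (crossingEvent n) := by
  have : crossingEvent n = ⋃ x ∈ box 3 n, ⋃ y ∈ innerBoundary (zdGraph 3) (box 3 (2 * n)),
      openConnIn (↑(box 3 (2 * n)) : Set (Site 3)) x y := by
    ext ω
    simp only [crossingEvent, Set.mem_setOf_eq, Set.mem_iUnion, exists_prop]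
  rw [this]
  exact Finset.measurableSet_biUnion _ fun x _ => Finset.measurableSet_biUnion _ fun y _ =>
    DCT16.measurableSet_openConnIn _ x y

/-- Blocking costs nothing: `{blocked} ⊆ E_n(b)` for `b ≥ 0` (`E_n(b)` = the budget event of the
route items, written out; it is `budgetEvent n b` of `Negative/AllOpenCutsets.lean`). [folklore] -/
theorem compl_crossingEvent_subset_budgetEvent {n : ℕ} {b : ℝ} (hb : 0 ≤ b) :
    (crossingEvent n)ᶜ ⊆ {ω | ∃ S : Finset (Sym2 (Site 3)), (S.card : ℝ) ≤ b ∧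
      ¬ ∃ x ∈ box 3 n, ∃ y ∈ innerBoundary (zdGraph 3) (box 3 (2 * n)),
        (ω \ ↑S) ∈ openConnIn (↑(box 3 (2 * n)) : Set (Site 3)) x y} := by
  intro ω hω
  refine ⟨∅, by simpa using hb, ?_⟩
  simpa [crossingEvent] using hω

/-- A budget `< 1` means budget `0`: `E_n(b) ⊆ {blocked}` for `b < 1`. [folklore] -/
theorem budgetEvent_subset_compl_crossingEvent {n : ℕ} {b : ℝ} (hb : b < 1) :
    {ω | ∃ S : Finset (Sym2 (Site 3)), (S.card : ℝ) ≤ b ∧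
      ¬ ∃ x ∈ box 3 n, ∃ y ∈ innerBoundary (zdGraph 3) (box 3 (2 * n)),
        (ω \ ↑S) ∈ openConnIn (↑(box 3 (2 * n)) : Set (Site 3)) x y} ⊆ (crossingEvent n)ᶜ := by
  rintro ω ⟨S, hS, hcut⟩ hcross
  have hlt : S.card < 1 := by exact_mod_cast hS.trans_lt hb
  have hS0 : S = ∅ := Finset.card_eq_zero.1 (by omega)
  subst hS0
  apply hcut
  simpa [crossingEvent] using hcross

/-- `1 - P_p(crossed) ≤ P_p(E_n(b))` for `b ≥ 0`. [folklore] -/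
theorem one_sub_real_crossingEvent_le (p : unitInterval) (n : ℕ) {b : ℝ} (hb : 0 ≤ b) :
    1 - (bondPercolation (zdGraph 3) p).real (crossingEvent n) ≤
      (bondPercolation (zdGraph 3) p).real {ω | ∃ S : Finset (Sym2 (Site 3)), (S.card : ℝ) ≤ b ∧
        ¬ ∃ x ∈ box 3 n, ∃ y ∈ innerBoundary (zdGraph 3) (box 3 (2 * n)),
          (ω \ ↑S) ∈ openConnIn (↑(box 3 (2 * n)) : Set (Site 3)) x y} := by
  calc 1 - (bondPercolation (zdGraph 3) p).real (crossingEvent n)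
        = (bondPercolation (zdGraph 3) p).real (crossingEvent n)ᶜ := by
          rw [measureReal_compl (measurableSet_crossingEvent n), probReal_univ]
    _ ≤ _ := measureReal_mono (compl_crossingEvent_subset_budgetEvent hb)

/-- A crossing of `A(n,2n)` from `x ∈ B(n)` contains an arm of length `n` at `x` (for
configurations on the lattice, `ω ⊆ E(ℤ³)`, which holds `P_p`-a.s.). [folklore] -/
theorem mem_iUnion_armEvent_of_mem_crossingEvent {n : ℕ} {ω : BondConfig (Site 3)}
    (hωE : ω ⊆ (zdGraph 3).edgeSet) (hω : ω ∈ crossingEvent n) :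
    ω ∈ ⋃ x ∈ box 3 n, DCT16.armEvent x n := by
  obtain ⟨x, hx, y, hy, hconn⟩ := hω
  simp only [Set.mem_iUnion, exists_prop]
  refine ⟨x, hx, DCT16.armEvent_of_pathIn hωE (DCT16.pathIn_of_mem_openConnIn hconn) ?_⟩
  by_cases hyx : y - x ∈ box 3 n
  · right
    obtain ⟨i, hi⟩ := DCT16.exists_natAbs_eq_of_mem_innerBoundary_box hy
    refine DCT16.mem_innerBoundary_box_of_natAbs_eq hyx (i := i) ?_
    have h1 := (mem_box.1 hx) i
    have h2 := (mem_box.1 hyx) i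
    simp only [Pi.sub_apply] at h2 ⊢
    omega
  · exact Or.inl hyx

/-- **Union bound**: `P_p(B(n) ↔ ∂B(2n) in B(2n)) ≤ (2n+1)³ · P_p(0 ↔ ∂B(n))`, at every `p`. [folklore] -/
theorem real_crossingEvent_le (p : unitInterval) (n : ℕ) :
    (bondPercolation (zdGraph 3) p).real (crossingEvent n) ≤
      (2 * n + 1) ^ 3 * (bondPercolation (zdGraph 3) p).real (siteToBoundary 3 n) := by
  set μ := bondPercolation (zdGraph 3) p with hμ
  have hae : ∀ᵐ ω ∂μ, ω ⊆ (zdGraph 3).edgeSet := by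
    rw [hμ, bondPercolation]
    exact ProbabilityTheory.setBernoulli_ae_subset
  have h1 : μ.real (crossingEvent n) ≤ μ.real (⋃ x ∈ box 3 n, DCT16.armEvent x n) := by
    rw [measureReal_def, measureReal_def]
    refine ENNReal.toReal_mono (measure_ne_top _ _) (measure_mono_ae ?_)
    filter_upwards [hae] with ω hωE hω
    exact mem_iUnion_armEvent_of_mem_crossingEvent hωE hω
  have h2 : μ.real (⋃ x ∈ box 3 n, DCT16.armEvent x n) ≤
      ∑ x ∈ box 3 n, μ.real (DCT16.armEvent x n) := measureReal_biUnion_finset_le _ _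
  have h3 : ∑ x ∈ box 3 n, μ.real (DCT16.armEvent x n) =
      (2 * n + 1) ^ 3 * μ.real (siteToBoundary 3 n) := by
    simp only [hμ, DCT16.real_armEvent, Finset.sum_const, card_box, nsmul_eq_mul]
    push_cast
    ring
  linarith

/-- **Below `p_c` the annulus is blocked with probability `→ 1`**:
`P_p(B(n) ↔ ∂B(2n) in B(2n)) → 0` for `p < p_c(ℤ³)` (sharpness + union bound). [folklore] -/
theorem tendsto_real_crossingEvent_of_lt_critical (p : unitInterval)
    (hp : (p : ℝ) < criticalProb (zdGraph 3) (0 : Site 3)) :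
    Tendsto (fun n : ℕ => (bondPercolation (zdGraph 3) p).real (crossingEvent n)) atTop (𝓝 0) := by
  obtain ⟨ψ, hψ, hdecay⟩ := DCT16.perc_sharpness_holds (d := 3) (by norm_num) p hp
  have hg : Tendsto (fun n : ℕ => 27 / ψ ^ 3 * ((ψ * n) ^ 3 * Real.exp (-(ψ * n)))) atTop
      (𝓝 (27 / ψ ^ 3 * 0)) :=
    ((Real.tendsto_pow_mul_exp_neg_atTop_nhds_zero 3).comp
      (tendsto_natCast_atTop_atTop.const_mul_atTop hψ)).const_mul _
  rw [mul_zero] at hg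
  refine tendsto_of_tendsto_of_tendsto_of_le_of_le' tendsto_const_nhds hg
    (Eventually.of_forall fun n => measureReal_nonneg) ?_
  filter_upwards [eventually_ge_atTop 1] with n hn
  have hn' : (1 : ℝ) ≤ n := by exact_mod_cast hn
  calc (bondPercolation (zdGraph 3) p).real (crossingEvent n)
      ≤ (2 * n + 1) ^ 3 * (bondPercolation (zdGraph 3) p).real (siteToBoundary 3 n) :=
        real_crossingEvent_le p n
    _ ≤ (2 * n + 1) ^ 3 * Real.exp (-ψ * n) := by
        gcongr
        exact hdecay n
    _ ≤ (3 * n) ^ 3 * Real.exp (-(ψ * n)) := by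
        rw [neg_mul]
        gcongr
        linarith
    _ = 27 / ψ ^ 3 * ((ψ * n) ^ 3 * Real.exp (-(ψ * n))) := by
        field_simp
        norm_num

/-- **The crux's conclusion holds at every `p < p_c(ℤ³)`, with EVERY saving `c`** (the statement of
`DefectDimension` with `criticalProbI 3` replaced by a subcritical `p`, and `c` arbitrary):
`P_p(E_n(n^{2-c})) ≥ P_p(blocked) → 1`. Together with `defectDimension_false_at_one` the crux is
exactly the critical case. [folklore] -/
theorem defectDimension_shape_below_critical (p : unitInterval)
    (hp : (p : ℝ) < criticalProb (zdGraph 3) (0 : Site 3)) (c : ℝ) :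
    Tendsto (fun n : ℕ => (bondPercolation (zdGraph 3) p).real
      {ω | ∃ S : Finset (Sym2 (Site 3)), (S.card : ℝ) ≤ (n : ℝ) ^ (2 - c) ∧
        ¬ ∃ x ∈ box 3 n, ∃ y ∈ innerBoundary (zdGraph 3) (box 3 (2 * n)),
          (ω \ ↑S) ∈ openConnIn (↑(box 3 (2 * n)) : Set (Site 3)) x y}) atTop (𝓝 1) := by
  have hlow : Tendsto (fun n : ℕ => 1 - (bondPercolation (zdGraph 3) p).real (crossingEvent n))
      atTop (𝓝 1) := by
    simpa using (tendsto_const_nhds (x := (1 : ℝ))).sub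
      (tendsto_real_crossingEvent_of_lt_critical p hp)
  refine tendsto_of_tendsto_of_tendsto_of_le_of_le' hlow tendsto_const_nhds
    (Eventually.of_forall fun n =>
      one_sub_real_crossingEvent_le p n (Real.rpow_nonneg (Nat.cast_nonneg n) _))
    (Eventually.of_forall fun n => measureReal_le_one)

end Summit.CriticalPhenomena.PercolationContinuityZ3.Theorems.DefectDimension.Negative

end
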